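import Literature.Probability.LatticeModels.FKIsingRSW
import Literature.Probability.LatticeModels.RandomClusterFKG
import Mathlib.MeasureTheory.Integral.Bochner.Basic
import Mathlib.Algebra.Order.BigOperators.Ring.Finset
import HarnessLib

/-!
# RSW for the critical FK-Ising model: the second-moment reduction, proved

Topic `Literature/Probability/LatticeModels` (trunk `StatMech`, family `crit-ising`). Companion
("Proofs") file of `FKIsingRSW.lean`, whose named fact
`Literature.Probability.LatticeModels.fkIsing_rsw` (Duminil-Copin–Smirnov, Clay Math. Proc. 15
(2012), Thm. 3.16 = Duminil-Copin–Hongler–Nolin, Comm. Pure Appl. Math. 64 (2011), Thm. 1 with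
free boundary conditions) is **not** discharged here: its printed proof (DCHN 2011, §§3–4) rests
on the critical FK fermionic observable in general Dobrushin subdomains of `ℤ²`, Smirnov's
comparison of `H = Im ∫ F²` with modified harmonic measures and random-walk estimates, none of
which is in the tree. What is proved here is the last step of that proof, the **second-moment
method** (DCHN 2011, proof of Thm. 1, Step 1; DCS 2012, §7.2, proof of Thm. 3.16 (sketch)):

* `rswPairCount n ω = N_n(ω)`, the number of pairs `(x, y)`, `x` on the left side `{x₀ = 0}` and
  `y` on the right side `{x₀ = 4n}` of the rectangle `[0, 4n] × [0, n]`, joined by an open path of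
  `ω` ("Let `N_n` be the number of connected pairs `(x,u)`", DCHN p. 14);
* `rswPairCount_pos_iff`: `N_n > 0` iff there is an open left-right crossing
  ("`P⁰(C_v(R)) = P⁰(N_n > 0)`", DCHN p. 14);
* `integral_rcMeasure`: expectations under the finite-graph random-cluster measure
  `rcMeasure G p q B` of `RandomCluster.lean` are the finite sums `∑_{ω ⊆ E} (w(ω)/Z) F(ω)`;
* `fkIsing_rsw_of_pairCount_moments`: if `φ⁰[N_n] ≥ c n` and `φ⁰[N_n²] ≤ C n²` for all `n ≥ 1`
  (DCHN eqs. "`E⁰[N_n] ≥ c₆(β) n`", "`E⁰[N_n²] ≤ c₇ n²`"), then `fkIsing_rsw` holds, with the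
  constant `c² / max C 1`: by the Cauchy–Schwarz inequality
  `φ⁰(N_n > 0) φ⁰[N_n²] ≥ φ⁰[N_n 1_{N_n > 0}]² = φ⁰[N_n]²` (DCHN p. 14, last display of Step 1;
  DCS 2012 p. 33).

The two moment bounds themselves (DCHN Prop. 13 summed over pairs far from the corners, and
Prop. 14 with the domain Markov property and FKG) are the open analytic inputs; they are
hypotheses of the reduction, not named facts.

## References

* H. Duminil-Copin, C. Hongler, P. Nolin, *Connection probabilities and RSW-type bounds for the
  two-dimensional FK Ising model*, Comm. Pure Appl. Math. 64 (2011) 1165–1198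
  (arXiv:0912.4253): Thm. 1, §4 (Props. 13, 14, proof of Thm. 1, Step 1).
* H. Duminil-Copin, S. Smirnov, *Conformal invariance of lattice models*, Clay Math. Proc. 15
  (2012) 213–276 (arXiv:1109.1549): Thm. 3.16, §7.2.
* Mathlib: `Finset.sum_sq_le_sum_mul_sum_of_sq_le_mul` (Cauchy–Schwarz for finite sums),
  `MeasureTheory.integral_finsetSum_measure`, `MeasureTheory.integral_dirac`.
-/

noncomputable section

open MeasureTheory Finset
open Literature.Probability.LatticeModels Literature.Probability.Percolation

namespace Literature.Probability.LatticeModels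

/-! ### Expectations under the finite random-cluster measure -/

section Integral

variable {V : Type*} [Fintype V] [DecidableEq V] (G : SimpleGraph V) [DecidableRel G.Adj]

/-- Expectation under the random-cluster measure of a finite graph as a finite sum:
`φ^B_{G,p,q}[F] = ∑_{ω ⊆ E(G)} (w(ω)/Z) F(ω)` for `0 ≤ p ≤ 1`, `0 < q` (the measure is the
explicit finite sum of Dirac masses of `RandomCluster.lean`). (Grimmett 2006, §1.2, eq. (1.2).)
[cite: Grimmett2006, §1.2, eq. (1.2)] -/
theorem integral_rcMeasure {p q : ℝ} (hp : p ∈ Set.Icc (0 : ℝ) 1) (hq : 0 < q) (B : Set V)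
    (F : Percolation.BondConfig V → ℝ) :
    ∫ ω, F ω ∂(rcMeasure G p q B) =
      ∑ ω ∈ G.edgeFinset.powerset,
        rcWeight G p q B ω / rcPartitionFunction G p q B * F (↑ω : Percolation.BondConfig V) := by
  have hZ := rcPartitionFunction_pos G hp hq B
  unfold rcMeasure
  rw [integral_finsetSum_measure]
  · refine Finset.sum_congr rfl fun ω _ ↦ ?_
    rw [integral_smul_measure, integral_dirac, ENNReal.toReal_ofReal, smul_eq_mul]
    exact div_nonneg (rcWeight_nonneg G hp hq.le B ω) hZ.le
  · intro ω _
    exact (integrable_dirac (by simp)).smul_measure ENNReal.ofReal_ne_top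

end Integral

/-! ### The number `N_n` of connected left-right pairs -/

open scoped Classical in
/-- `N_n(ω)`: the number of pairs `(x, y)` of sites of the lattice rectangle `[0, 4n] × [0, n]`,
`x` on the left side `{x₀ = 0}`, `y` on the right side `{x₀ = 4n}`, that are joined by an open
path of `ω` (inside the rectangle, on whose sites `ω` lives). (DCHN 2011, proof of Thm. 1,
Step 1: "Let `N_n` be the number of connected pairs `(x, u)`, with `x ∈ ∂₋R`, `u ∈ ∂₊R`"; DCS
2012, §7.2.) [cite: DuminilCopinHonglerNolin2011, §4, proof of Thm. 1, Step 1] -/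
def rswPairCount (n : ℕ) (ω : BondConfig ↥(rectangle (4 * n) n : Set (Site 2))) : ℕ :=
  #{xy : ↥(rectangle (4 * n) n : Set (Site 2)) × ↥(rectangle (4 * n) n : Set (Site 2)) |
      xy.1.1 0 = 0 ∧ xy.2.1 0 = ((4 * n : ℕ) : ℤ) ∧ ω ∈ openConnIn Set.univ xy.1 xy.2}

/-- `N_n(ω) > 0` iff `ω` has an open left-right crossing of `[0, 4n] × [0, n]`
("`P⁰(C_v(R)) = P⁰(N_n > 0)`", DCHN 2011, proof of Thm. 1, Step 1).
[cite: DuminilCopinHonglerNolin2011, §4, proof of Thm. 1, Step 1] -/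
theorem rswPairCount_pos_iff {n : ℕ} {ω : BondConfig ↥(rectangle (4 * n) n : Set (Site 2))} :
    0 < rswPairCount n ω ↔
      ω ∈ openCrossing Set.univ {x | x.1 0 = 0} {x | x.1 0 = ((4 * n : ℕ) : ℤ)} := by
  classical
  rw [rswPairCount, Finset.card_pos, Finset.filter_nonempty_iff, mem_openCrossing_iff]
  constructor
  · rintro ⟨⟨x, y⟩, -, hx, hy, h⟩
    exact ⟨x, hx, y, hy, h⟩
  · rintro ⟨x, hx, y, hy, h⟩
    exact ⟨⟨x, y⟩, Finset.mem_univ _, hx, hy, h⟩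

/-! ### DCHN 2011, proof of Theorem 1, Step 1: the second-moment method -/

/-- **The second-moment reduction of the RSW bound** (Duminil-Copin–Hongler–Nolin 2011, proof of
Thm. 1, Step 1; Duminil-Copin–Smirnov 2012, §7.2): if, under the critical FK-Ising measure with
free boundary conditions of `[0, 4n] × [0, n]`, the number `N_n` of connected left-right pairs
satisfies `φ⁰[N_n] ≥ c n` and `φ⁰[N_n²] ≤ C n²` for all `n ≥ 1` (some `c > 0`, `C`), then the
open left-right crossing has probability at least `c² / max C 1` for all `n ≥ 1`, i.e. the named
fact `fkIsing_rsw` holds: by the Cauchy–Schwarz inequality,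
`φ⁰(N_n > 0) · φ⁰[N_n²] ≥ φ⁰[N_n · 1_{N_n > 0}]² = φ⁰[N_n]²`.
[cite: DuminilCopinHonglerNolin2011, §4, proof of Thm. 1, Step 1; DuminilCopinSmirnov2012Clay, §7.2] -/
theorem fkIsing_rsw_of_pairCount_moments
    (h₁ : ∃ c : ℝ, 0 < c ∧ ∀ n : ℕ, 1 ≤ n →
      c * n ≤ ∫ ω, (rswPairCount n ω : ℝ) ∂(fkIsingFiniteMeasure (rectangle (4 * n) n) ∅))
    (h₂ : ∃ C : ℝ, ∀ n : ℕ, 1 ≤ n →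
      ∫ ω, (rswPairCount n ω : ℝ) ^ 2 ∂(fkIsingFiniteMeasure (rectangle (4 * n) n) ∅) ≤
        C * (n : ℝ) ^ 2) :
    fkIsing_rsw := by
  obtain ⟨c, hc, h₁⟩ := h₁
  obtain ⟨C, h₂⟩ := h₂
  refine ⟨c ^ 2 / max C 1, by positivity, fun n hn ↦ ?_⟩
  have hM : 0 < max C 1 := lt_max_of_lt_right one_pos
  -- the rectangle, its graph, the weights `π(ω) = w(ω)/Z` and `N` on edge sets
  set S : Finset (Site 2) := rectangle (4 * n) n
  set Γ : SimpleGraph ↥(S : Set (Site 2)) := (zdGraph 2).induce (S : Set (Site 2))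
  set A : Set (BondConfig ↥(S : Set (Site 2))) :=
    openCrossing Set.univ {x | x.1 0 = 0} {x | x.1 0 = ((4 * n : ℕ) : ℤ)}
  set π : Finset (Sym2 ↥(S : Set (Site 2))) → ℝ := fun ω ↦
    rcWeight Γ criticalFKIsingParam 2 ∅ ω / rcPartitionFunction Γ criticalFKIsingParam 2 ∅
  set N : Finset (Sym2 ↥(S : Set (Site 2))) → ℝ := fun ω ↦
    (rswPairCount n (↑ω : BondConfig ↥(S : Set (Site 2))) : ℝ) with hN
  have hp := criticalFKIsingParam_mem_Icc
  have hZ := rcPartitionFunction_pos Γ hp two_pos ∅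
  have hπ0 : ∀ ω, 0 ≤ π ω := fun ω ↦ div_nonneg (rcWeight_nonneg Γ hp two_pos.le ∅ ω) hZ.le
  -- the three quantities as finite sums
  have hE1 : ∫ ω, (rswPairCount n ω : ℝ) ∂(fkIsingFiniteMeasure S ∅) =
      ∑ ω ∈ Γ.edgeFinset.powerset, π ω * N ω := by
    simp only [fkIsingFiniteMeasure]
    exact integral_rcMeasure Γ hp two_pos ∅ _
  have hE2 : ∫ ω, (rswPairCount n ω : ℝ) ^ 2 ∂(fkIsingFiniteMeasure S ∅) =
      ∑ ω ∈ Γ.edgeFinset.powerset, π ω * N ω ^ 2 := by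
    simp only [fkIsingFiniteMeasure]
    exact integral_rcMeasure Γ hp two_pos ∅ fun ω ↦ (rswPairCount n ω : ℝ) ^ 2
  classical
  have hP : (fkIsingFiniteMeasure S ∅).real A =
      ∑ ω ∈ Γ.edgeFinset.powerset, if (↑ω : BondConfig ↥(S : Set (Site 2))) ∈ A then π ω else 0 := by
    simp only [fkIsingFiniteMeasure]
    convert rcMeasure_real_apply Γ hp two_pos ∅ A using 1
  -- Cauchy–Schwarz: `φ[N]² = φ[N 1_{N>0}]² ≤ φ(N > 0) φ[N²]`
  have hCS : (∑ ω ∈ Γ.edgeFinset.powerset, π ω * N ω) ^ 2 ≤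
      (∑ ω ∈ Γ.edgeFinset.powerset, if (↑ω : BondConfig ↥(S : Set (Site 2))) ∈ A then π ω else 0) *
        ∑ ω ∈ Γ.edgeFinset.powerset, π ω * N ω ^ 2 := by
    refine Finset.sum_sq_le_sum_mul_sum_of_sq_le_mul _ (fun ω _ ↦ ?_) (fun ω _ ↦ ?_) (fun ω _ ↦ ?_)
    · split_ifs
      · exact hπ0 ω
      · exact le_rfl
    · exact mul_nonneg (hπ0 ω) (sq_nonneg _)
    · by_cases hω : (↑ω : BondConfig ↥(S : Set (Site 2))) ∈ A
      · rw [if_pos hω]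
        exact le_of_eq (by ring)
      · have h0 : N ω = 0 := by
          have : ¬ 0 < rswPairCount n (↑ω : BondConfig ↥(S : Set (Site 2))) := by
            rwa [rswPairCount_pos_iff]
          simp only [hN, Nat.cast_eq_zero]
          omega
        rw [if_neg hω, h0]
        simp
  -- combine: `(c n)² ≤ φ[N]² ≤ φ(A) φ[N²] ≤ φ(A) · max C 1 · n²`
  have h1n := h₁ n hn
  have h2n := h₂ n hn
  rw [hE1] at h1n
  rw [hE2] at h2n
  rw [hP]
  set P := ∑ ω ∈ Γ.edgeFinset.powerset,
    if (↑ω : BondConfig ↥(S : Set (Site 2))) ∈ A then π ω else 0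
  have hP0 : 0 ≤ P := Finset.sum_nonneg fun ω _ ↦ by
    split_ifs
    · exact hπ0 ω
    · exact le_rfl
  have hcn : 0 ≤ c * n := by positivity
  have hn2 : (0 : ℝ) < (n : ℝ) ^ 2 := by positivity
  have key : (c * n) ^ 2 ≤ P * (max C 1 * (n : ℝ) ^ 2) :=
    calc (c * n) ^ 2 ≤ (∑ ω ∈ Γ.edgeFinset.powerset, π ω * N ω) ^ 2 :=
          pow_le_pow_left₀ hcn h1n 2
      _ ≤ P * ∑ ω ∈ Γ.edgeFinset.powerset, π ω * N ω ^ 2 := hCS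
      _ ≤ P * (C * (n : ℝ) ^ 2) := mul_le_mul_of_nonneg_left h2n hP0
      _ ≤ P * (max C 1 * (n : ℝ) ^ 2) :=
          mul_le_mul_of_nonneg_left (mul_le_mul_of_nonneg_right (le_max_left _ _) hn2.le) hP0
  rw [div_le_iff₀ hM]
  have : c ^ 2 * (n : ℝ) ^ 2 ≤ P * max C 1 * (n : ℝ) ^ 2 := by
    calc c ^ 2 * (n : ℝ) ^ 2 = (c * n) ^ 2 := by ring
      _ ≤ P * (max C 1 * (n : ℝ) ^ 2) := key
      _ = P * max C 1 * (n : ℝ) ^ 2 := by ring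
  exact le_of_mul_le_mul_right this hn2

/-! ### The moments of `N_n` as sums of connection probabilities

DCHN 2011, proof of Thm. 1, Step 1: "The expected value of this quantity is equal to
`E⁰[N_n] = ∑_{u ∈ ∂₊R, x ∈ ∂₋R} P⁰(x ↔ u)`", and, for the second moment, the sum over two pairs
of the probabilities of simultaneous connections `P⁰(x ↔ u, y ↔ v)`. These identities turn the two
hypotheses of `fkIsing_rsw_of_pairCount_moments` into statements about two- and four-point
connection probabilities (DCHN Props. 13 and 14). -/

/-- The (left side) × (right side) pairs of sites of `[0, 4n] × [0, n]`: `x₀ = 0`, `y₀ = 4n`.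
(DCHN 2011, proof of Thm. 1, Step 1, the index set of `N_n`.)
[cite: DuminilCopinHonglerNolin2011, §4, proof of Thm. 1, Step 1] -/
def rswPairs (n : ℕ) :
    Finset (↥(rectangle (4 * n) n : Set (Site 2)) × ↥(rectangle (4 * n) n : Set (Site 2))) :=
  {xy | xy.1.1 0 = 0 ∧ xy.2.1 0 = ((4 * n : ℕ) : ℤ)}

/-- Membership in `rswPairs n`. [folklore] -/
@[simp] theorem mem_rswPairs {n : ℕ}
    {xy : ↥(rectangle (4 * n) n : Set (Site 2)) × ↥(rectangle (4 * n) n : Set (Site 2))} :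
    xy ∈ rswPairs n ↔ xy.1.1 0 = 0 ∧ xy.2.1 0 = ((4 * n : ℕ) : ℤ) := by
  simp [rswPairs]

open scoped Classical in
/-- `N_n(ω) = ∑_{(x,y) ∈ left × right} 1{x ↔ y in ω}` (as a real number). (DCHN 2011, proof of
Thm. 1, Step 1.) [cite: DuminilCopinHonglerNolin2011, §4, proof of Thm. 1, Step 1] -/
theorem rswPairCount_eq_sum (n : ℕ) (ω : BondConfig ↥(rectangle (4 * n) n : Set (Site 2))) :
    (rswPairCount n ω : ℝ) =
      ∑ xy ∈ rswPairs n, if ω ∈ openConnIn Set.univ xy.1 xy.2 then (1 : ℝ) else 0 := by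
  classical
  rw [rswPairCount, Finset.card_filter, Nat.cast_sum, rswPairs, Finset.sum_filter]
  refine Finset.sum_congr rfl fun xy _ ↦ ?_
  by_cases h1 : xy.1.1 0 = 0 <;> by_cases h2 : xy.2.1 0 = ((4 * n : ℕ) : ℤ) <;>
    by_cases h3 : ω ∈ openConnIn Set.univ xy.1 xy.2 <;> simp [h1, h2, h3]

/-- **First moment of `N_n`** (DCHN 2011, proof of Thm. 1, Step 1:
"`E⁰[N_n] = ∑_{x, u} P⁰(x ↔ u)`"): under the critical free FK-Ising measure of `[0, 4n] × [0, n]`,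
`φ⁰[N_n] = ∑_{(x,y) ∈ left × right} φ⁰(x ↔ y)`.
[cite: DuminilCopinHonglerNolin2011, §4, proof of Thm. 1, Step 1] -/
theorem integral_rswPairCount (n : ℕ) :
    ∫ ω, (rswPairCount n ω : ℝ) ∂(fkIsingFiniteMeasure (rectangle (4 * n) n) ∅) =
      ∑ xy ∈ rswPairs n,
        (fkIsingFiniteMeasure (rectangle (4 * n) n) ∅).real (openConnIn Set.univ xy.1 xy.2) := by
  classical
  have hp := criticalFKIsingParam_mem_Icc
  simp only [fkIsingFiniteMeasure]
  rw [integral_rcMeasure _ hp two_pos ∅]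
  simp_rw [rswPairCount_eq_sum, Finset.mul_sum]
  rw [Finset.sum_comm]
  refine Finset.sum_congr rfl fun xy _ ↦ ?_
  rw [rcMeasure_real_apply _ hp two_pos ∅]
  refine Finset.sum_congr rfl fun ω _ ↦ ?_
  split_ifs <;> simp

/-- **Second moment of `N_n`** (DCHN 2011, proof of Thm. 1, Step 1, the sum over
`x, y ∈ ∂₋R`, `u, v ∈ ∂₊R` of `P⁰(x ↔ u, y ↔ v)`): under the critical free FK-Ising measure of
`[0, 4n] × [0, n]`, `φ⁰[N_n²] = ∑_{(x,u)} ∑_{(y,v)} φ⁰(x ↔ u and y ↔ v)`.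
[cite: DuminilCopinHonglerNolin2011, §4, proof of Thm. 1, Step 1] -/
theorem integral_rswPairCount_sq (n : ℕ) :
    ∫ ω, (rswPairCount n ω : ℝ) ^ 2 ∂(fkIsingFiniteMeasure (rectangle (4 * n) n) ∅) =
      ∑ xy ∈ rswPairs n, ∑ xy' ∈ rswPairs n,
        (fkIsingFiniteMeasure (rectangle (4 * n) n) ∅).real
          (openConnIn Set.univ xy.1 xy.2 ∩ openConnIn Set.univ xy'.1 xy'.2) := by
  classical
  have hp := criticalFKIsingParam_mem_Icc
  simp only [fkIsingFiniteMeasure]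
  rw [integral_rcMeasure _ hp two_pos ∅]
  simp_rw [rswPairCount_eq_sum, sq, Finset.sum_mul_sum, ite_zero_mul_ite_zero, one_mul,
    Finset.mul_sum]
  rw [Finset.sum_comm]
  refine Finset.sum_congr rfl fun xy _ ↦ ?_
  rw [Finset.sum_comm]
  refine Finset.sum_congr rfl fun xy' _ ↦ ?_
  rw [rcMeasure_real_apply _ hp two_pos ∅]
  refine Finset.sum_congr rfl fun ω _ ↦ ?_
  simp only [Set.mem_inter_iff]
  split_ifs <;> simp

end Literature.Probability.LatticeModels
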